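import Summits.CriticalPhenomena.PercolationContinuityZ3.Theorems.PercNearOneGluingNoHeavyLowerTailSahiGridPatternThreeStarPrelim

/-!
# `NoHeavyLowerTail` (crux stmt-CriticalPhenomena-4575), Sahi programme P1: **THE THREE-BLOCK STAR CERTIFICATE** (kernel forms) —
# every ingredient of the core inequality as a pair sum over the orthant block `[3]^k` with both literal axes made explicit

Support file (Sahi cell, seat `prim-sahi-p1`, generation 22; `--supports stmt-CriticalPhenomena-4575`).  Pure proofs, no definitions,
no `sorry`, standard axioms.  Setting of `…ThreeStarPrelim` (`[3]^{1+(k+1)} = [3]^1 × ([3]^k × [3]^1)`, points `glue ξ (glue t p)`;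
`X₂, Y₂` the orthant `↑b` and the literal `{p = 2}` at level 2, `X₃, Y₃` the literal `{ξ = 2}` and the cylinder over `U' = X₂ ∪ Y₂`).

THE MATHEMATICS.  Write `[t δ̸ t']` for total distinctness in the orthant block and `t'' = thirdPt t t'`.  Because both literal axes are
copies of `[3]^1`, every pair sum over `[3]^1` is an explicit sum over the six orderings of `(0,1,2)` (`pairSum_pd1`), so every quantity
of the three-block problem is a single pair sum `Σ_{t,t'} [t δ̸ t']·K(t,t',t'')` over the ORTHANT block whose kernel `K` is a polynomial in the
`27 + 27` point indicators `1_A(glue i (glue s j))`, `1_{A'}(…)` (`i, j ∈ [3]`, `s ∈ {t,t',t''}`) and the three orthant indicators `1_{↑b}(s)`.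
THIS FILE provides these kernel ("T-") forms: the generic re-indexing lemmas (`pairSum3_pd1_explicit`, `pairSum_cell_pd1_explicit`,
`pairSum2_pd1_explicit`, `pairSum_sym6`), the T-form of the `δ`-part of the certificate (`threeStar_delta_sum_eq`), and the NONNEGATIVE
FAMILIES of the decomposition of the core inequality in T-form: coefficientwise Harris (`harris_tform_nonneg`), fibre Kleitman
(`kleitman_tform_nonneg`), the LEVEL-2 TWO-ORTHANT SLACK `sStarD (X₂∪Y₂) P Q − Φ₂(P∩Q) ≥ 0` of `…TwoOrthant{,Top}` for the sections
(`twoOrthantCell_tform_nonneg`, the orthant pays), and the trivial family of products of monotone differences (`threeStar_R_tform_nonneg`).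
The kernel identity that ties them to the core inequality is `…ThreeStar`.  Kernel texts generated from the seat's symbolic engine
(code/gen22/symid*.py, genlean.py), where the identity is verified as a polynomial identity. [this work]
-/

namespace Summit.CriticalPhenomena.PercolationContinuityZ3.Theorems.SahiGridPattern

open Finset SahiGrid3
open scoped BigOperators

variable {k m : ℕ}

/-! ### Generic re-indexing: literal axes explicit -/

/-- A two-block pair sum over `[3]^1 × [3]^m` (kernel without the third points) is a pair sum over `[3]^m` of the six orderings. [this work] -/
theorem pairSum3_pd1_explicit (κ : Pd 1 → Pd 1 → Pd m → Pd m → ℤ) :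
    (∑ ξ : Pd 1, ∑ η : Pd 1, ∑ z : Pd m, ∑ z' : Pd m,
        (if TotDist ξ η = true then (1:ℤ) else 0) * (if TotDist z z' = true then (1:ℤ) else 0) * κ ξ η z z')
      = ∑ z : Pd m, ∑ z' : Pd m, (if TotDist z z' = true then (1:ℤ) else 0) *
          (κ (fun _ => 0) (fun _ => 1) z z' + κ (fun _ => 0) (fun _ => 2) z z' + κ (fun _ => 1) (fun _ => 0) z z'
            + κ (fun _ => 1) (fun _ => 2) z z' + κ (fun _ => 2) (fun _ => 0) z z' + κ (fun _ => 2) (fun _ => 1) z z') := by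
  rw [sum_comm4]
  refine Finset.sum_congr rfl fun z _ => Finset.sum_congr rfl fun z' _ => ?_
  have h := pairSum_pd1 (fun ξ η _ => κ ξ η z z')
  rw [← h, Finset.mul_sum]
  refine Finset.sum_congr rfl fun ξ _ => ?_
  rw [Finset.mul_sum]
  refine Finset.sum_congr rfl fun η _ => ?_
  ring

/-- A pair sum over `[3]^{k+1} = [3]^k × [3]^1` is a pair sum over `[3]^k` of the six orderings of the literal axis. [this work] -/
theorem pairSum_cell_pd1_explicit (F : Pd (k + 1) → Pd (k + 1) → ℤ) :
    (∑ z : Pd (k + 1), ∑ z' : Pd (k + 1), (if TotDist z z' = true then (1:ℤ) else 0) * F z z')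
      = ∑ t : Pd k, ∑ t' : Pd k, (if TotDist t t' = true then (1:ℤ) else 0) *
          (F (glue t (fun _ => 0)) (glue t' (fun _ => 1)) + F (glue t (fun _ => 0)) (glue t' (fun _ => 2))
            + F (glue t (fun _ => 1)) (glue t' (fun _ => 0)) + F (glue t (fun _ => 1)) (glue t' (fun _ => 2))
            + F (glue t (fun _ => 2)) (glue t' (fun _ => 0)) + F (glue t (fun _ => 2)) (glue t' (fun _ => 1))) := by
  have h := pairSum_glue (n := k) (k := 1) F
  have e1 : (∑ z : Pd (k + 1), ∑ z' : Pd (k + 1), (if TotDist z z' = true then (1:ℤ) else 0) * F z z')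
      = ∑ x : Pd (k + 1), ∑ y : Pd (k + 1), F x y * (if TotDist x y = true then (1:ℤ) else 0) :=
    Finset.sum_congr rfl fun z _ => Finset.sum_congr rfl fun z' _ => by ring
  rw [e1, h]
  refine Finset.sum_congr rfl fun t _ => Finset.sum_congr rfl fun t' _ => ?_
  have h2 := pairSum_pd1 (fun q r _ => F (glue t q) (glue t' r))
  rw [← h2, Finset.mul_sum]
  refine Finset.sum_congr rfl fun q _ => ?_
  rw [Finset.mul_sum]
  refine Finset.sum_congr rfl fun r _ => ?_
  ring

/-- A two-block pair sum over `[3]^m × [3]^1` (cell block the literal axis) is a pair sum over `[3]^m` of the six orderings. [this work] -/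
theorem pairSum2_pd1_explicit (κ : Pd m → Pd m → Pd 1 → Pd 1 → ℤ) :
    (∑ t : Pd m, ∑ t' : Pd m, ∑ p : Pd 1, ∑ p' : Pd 1,
        (if TotDist t t' = true then (1:ℤ) else 0) * (if TotDist p p' = true then (1:ℤ) else 0) * κ t t' p p')
      = ∑ t : Pd m, ∑ t' : Pd m, (if TotDist t t' = true then (1:ℤ) else 0) *
          (κ t t' (fun _ => 0) (fun _ => 1) + κ t t' (fun _ => 0) (fun _ => 2) + κ t t' (fun _ => 1) (fun _ => 0)
            + κ t t' (fun _ => 1) (fun _ => 2) + κ t t' (fun _ => 2) (fun _ => 0) + κ t t' (fun _ => 2) (fun _ => 1)) := by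
  refine Finset.sum_congr rfl fun t _ => Finset.sum_congr rfl fun t' _ => ?_
  have h := pairSum_pd1 (fun p p' _ => κ t t' p p')
  rw [← h, Finset.mul_sum]
  refine Finset.sum_congr rfl fun p _ => ?_
  rw [Finset.mul_sum]
  refine Finset.sum_congr rfl fun p' _ => ?_
  ring

/-- **Full symmetrisation of a pair sum**: `6·Σ[ξ δ̸ η]G(ξ,η,ζ) = Σ[ξ δ̸ η]·(sum of G over the six orderings of (ξ,η,ζ))`. [this work] -/
theorem pairSum_sym6 {d : ℕ} (G : Pd d → Pd d → Pd d → ℤ) :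
    6 * (∑ ξ : Pd d, ∑ η : Pd d, (if TotDist ξ η = true then (1:ℤ) else 0) * G ξ η (thirdPt ξ η))
      = ∑ ξ : Pd d, ∑ η : Pd d, (if TotDist ξ η = true then (1:ℤ) else 0) *
          (G ξ η (thirdPt ξ η) + G ξ (thirdPt ξ η) η + G η ξ (thirdPt ξ η) + G η (thirdPt ξ η) ξ
            + G (thirdPt ξ η) ξ η + G (thirdPt ξ η) η ξ) := by
  have h2 := pairSum_rot G
  have h3 := pairSum_swap G
  have h4 : (∑ ξ : Pd d, ∑ η : Pd d, (if TotDist ξ η = true then (1:ℤ) else 0) * G ξ η (thirdPt ξ η))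
      = ∑ ξ : Pd d, ∑ η : Pd d, (if TotDist ξ η = true then (1:ℤ) else 0) * G η (thirdPt ξ η) ξ := by
    rw [pairSum_rot G, pairSum_swap (fun a b c => G a c b)]
  have h5 : (∑ ξ : Pd d, ∑ η : Pd d, (if TotDist ξ η = true then (1:ℤ) else 0) * G ξ η (thirdPt ξ η))
      = ∑ ξ : Pd d, ∑ η : Pd d, (if TotDist ξ η = true then (1:ℤ) else 0) * G (thirdPt ξ η) ξ η := by
    rw [pairSum_swap G, pairSum_rot (fun a b c => G b a c)]
  have h6 : (∑ ξ : Pd d, ∑ η : Pd d, (if TotDist ξ η = true then (1:ℤ) else 0) * G ξ η (thirdPt ξ η))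
      = ∑ ξ : Pd d, ∑ η : Pd d, (if TotDist ξ η = true then (1:ℤ) else 0) * G (thirdPt ξ η) η ξ := by
    rw [pairSum_swap G, pairSum_rot (fun a b c => G b a c), pairSum_swap (fun a b c => G c a b)]
  have e : 6 * (∑ ξ : Pd d, ∑ η : Pd d, (if TotDist ξ η = true then (1:ℤ) else 0) * G ξ η (thirdPt ξ η))
      = (∑ ξ : Pd d, ∑ η : Pd d, (if TotDist ξ η = true then (1:ℤ) else 0) * G ξ η (thirdPt ξ η))
        + (∑ ξ : Pd d, ∑ η : Pd d, (if TotDist ξ η = true then (1:ℤ) else 0) * G ξ η (thirdPt ξ η))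
        + (∑ ξ : Pd d, ∑ η : Pd d, (if TotDist ξ η = true then (1:ℤ) else 0) * G ξ η (thirdPt ξ η))
        + (∑ ξ : Pd d, ∑ η : Pd d, (if TotDist ξ η = true then (1:ℤ) else 0) * G ξ η (thirdPt ξ η))
        + (∑ ξ : Pd d, ∑ η : Pd d, (if TotDist ξ η = true then (1:ℤ) else 0) * G ξ η (thirdPt ξ η))
        + (∑ ξ : Pd d, ∑ η : Pd d, (if TotDist ξ η = true then (1:ℤ) else 0) * G ξ η (thirdPt ξ η)) := by ring
  rw [e]
  nth_rewrite 2 [h2]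
  nth_rewrite 2 [h3]
  nth_rewrite 2 [h4]
  nth_rewrite 2 [h5]
  nth_rewrite 2 [h6]
  simp only [← Finset.sum_add_distrib]
  refine Finset.sum_congr rfl fun ξ _ => Finset.sum_congr rfl fun η _ => ?_
  ring

/-- Third points of glued points with explicit literal coordinates. [this work] -/
theorem thirdPt_glue_pd1 (t t' : Pd k) :
    thirdPt (glue t (fun _ => (0:Fin 3) : Pd 1)) (glue t' (fun _ => 1)) = glue (thirdPt t t') (fun _ => 2) ∧
    thirdPt (glue t (fun _ => (0:Fin 3) : Pd 1)) (glue t' (fun _ => 2)) = glue (thirdPt t t') (fun _ => 1) ∧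
    thirdPt (glue t (fun _ => (1:Fin 3) : Pd 1)) (glue t' (fun _ => 0)) = glue (thirdPt t t') (fun _ => 2) ∧
    thirdPt (glue t (fun _ => (1:Fin 3) : Pd 1)) (glue t' (fun _ => 2)) = glue (thirdPt t t') (fun _ => 0) ∧
    thirdPt (glue t (fun _ => (2:Fin 3) : Pd 1)) (glue t' (fun _ => 0)) = glue (thirdPt t t') (fun _ => 1) ∧
    thirdPt (glue t (fun _ => (2:Fin 3) : Pd 1)) (glue t' (fun _ => 1)) = glue (thirdPt t t') (fun _ => 0) := by
  obtain ⟨-, -, -, -, -, -, -, -, -, t01, t02, t10, t12, t20, t21⟩ := pd1_facts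
  refine ⟨?_, ?_, ?_, ?_, ?_, ?_⟩ <;> rw [thirdPt_glue]
  · rw [t01]
  · rw [t02]
  · rw [t10]
  · rw [t12]
  · rw [t20]
  · rw [t21]

/-! ### The `δ`-part of the certificate in T-form -/

/-- **T-form of the `δ`-sum**: `Σ_{x∈A∩A'} δ(x) = Σ_{t,t'}[t δ̸ t']·K_δ(t,t')`, `K_δ = Σ_{i∈{0,1}} [−a_{i0}a'_{i0} − a_{i1}a'_{i1} + 2a_{i2}a'_{i2}](t)·
1_{↑b}(t)(1 − 1_{↑b}(t'))` (`a_{ij}(t) = 1_A(glue i (glue t j))`). [this work] -/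
theorem threeStar_delta_sum_eq (b : Pd k) (ℓ : Pd 1) (hℓ : ℓ 0 = 2) {X₂ Y₂ : Finset (Pd (k + 1))} {X₃ : Finset (Pd (1 + (k + 1)))}
    (hX₂ : ∀ t p, glue t p ∈ X₂ ↔ t ∈ (univ.filter fun x : Pd k => ∀ j, b j ≤ x j))
    (hY₂ : ∀ t p, glue t p ∈ Y₂ ↔ p ∈ (univ.filter fun y : Pd 1 => ∀ j, ℓ j ≤ y j))
    (hX₃ : ∀ ξ z, glue ξ z ∈ X₃ ↔ ξ ∈ (univ.filter fun y : Pd 1 => ∀ j, ℓ j ≤ y j))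
    (A A' : Finset (Pd (1 + (k + 1)))) :
    (∑ x ∈ A ∩ A', (1 - ind X₃ x) * (((2:ℤ) ^ (k + 1) * (ind X₂ (cellOf x) + ind Y₂ (cellOf x))
            - ind X₂ (cellOf x) * ((nuCount (X₂ ∪ Y₂) (cellOf x) : ℤ) - nuCount X₂ (cellOf x))
            - ind X₂ (cellOf x) * ind Y₂ (cellOf x) * (nuCount X₂ (cellOf x) : ℤ))
          - 2 ^ (k + 1) * ind (X₂ ∪ Y₂) (cellOf x)))
      = ∑ t : Pd k, ∑ t' : Pd k, (if TotDist t t' = true then (1:ℤ) else 0) *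
          (
          -(ind A (glue (fun _ => 0) (glue t (fun _ => 0))) * ind A' (glue (fun _ => 0) (glue t (fun _ => 0))) * ind (univ.filter fun x : Pd k => ∀ j, b j ≤ x j) t)
          - ind A (glue (fun _ => 0) (glue t (fun _ => 1))) * ind A' (glue (fun _ => 0) (glue t (fun _ => 1))) * ind (univ.filter fun x : Pd k => ∀ j, b j ≤ x j) t
          + 2 * ind A (glue (fun _ => 0) (glue t (fun _ => 2))) * ind A' (glue (fun _ => 0) (glue t (fun _ => 2))) * ind (univ.filter fun x : Pd k => ∀ j, b j ≤ x j) t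
          - ind A (glue (fun _ => 1) (glue t (fun _ => 0))) * ind A' (glue (fun _ => 1) (glue t (fun _ => 0))) * ind (univ.filter fun x : Pd k => ∀ j, b j ≤ x j) t
          - ind A (glue (fun _ => 1) (glue t (fun _ => 1))) * ind A' (glue (fun _ => 1) (glue t (fun _ => 1))) * ind (univ.filter fun x : Pd k => ∀ j, b j ≤ x j) t
          + 2 * ind A (glue (fun _ => 1) (glue t (fun _ => 2))) * ind A' (glue (fun _ => 1) (glue t (fun _ => 2))) * ind (univ.filter fun x : Pd k => ∀ j, b j ≤ x j) t
          + ind A (glue (fun _ => 0) (glue t (fun _ => 0))) * ind A' (glue (fun _ => 0) (glue t (fun _ => 0))) * ind (univ.filter fun x : Pd k => ∀ j, b j ≤ x j) t * ind (univ.filter fun x : Pd k => ∀ j, b j ≤ x j) t'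
          + ind A (glue (fun _ => 0) (glue t (fun _ => 1))) * ind A' (glue (fun _ => 0) (glue t (fun _ => 1))) * ind (univ.filter fun x : Pd k => ∀ j, b j ≤ x j) t * ind (univ.filter fun x : Pd k => ∀ j, b j ≤ x j) t'
          - 2 * ind A (glue (fun _ => 0) (glue t (fun _ => 2))) * ind A' (glue (fun _ => 0) (glue t (fun _ => 2))) * ind (univ.filter fun x : Pd k => ∀ j, b j ≤ x j) t * ind (univ.filter fun x : Pd k => ∀ j, b j ≤ x j) t'
          + ind A (glue (fun _ => 1) (glue t (fun _ => 0))) * ind A' (glue (fun _ => 1) (glue t (fun _ => 0))) * ind (univ.filter fun x : Pd k => ∀ j, b j ≤ x j) t * ind (univ.filter fun x : Pd k => ∀ j, b j ≤ x j) t'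
          + ind A (glue (fun _ => 1) (glue t (fun _ => 1))) * ind A' (glue (fun _ => 1) (glue t (fun _ => 1))) * ind (univ.filter fun x : Pd k => ∀ j, b j ≤ x j) t * ind (univ.filter fun x : Pd k => ∀ j, b j ≤ x j) t'
          - 2 * ind A (glue (fun _ => 1) (glue t (fun _ => 2))) * ind A' (glue (fun _ => 1) (glue t (fun _ => 2))) * ind (univ.filter fun x : Pd k => ∀ j, b j ≤ x j) t * ind (univ.filter fun x : Pd k => ∀ j, b j ≤ x j) t') := by
  set Ob : Finset (Pd k) := univ.filter fun x : Pd k => ∀ j, b j ≤ x j with hOb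
  set L : Finset (Pd 1) := univ.filter fun y : Pd 1 => ∀ j, ℓ j ≤ y j with hL
  obtain ⟨i0, i1, i2⟩ := ind_literalTwo_vals ℓ hℓ
  obtain ⟨n0, n1, n2⟩ := nuCount_literalTwo_vals ℓ hℓ
  rw [← hL] at i0 i1 i2 n0 n1 n2
  -- left side: explicit `ξ`, then `z = glue t p` with explicit `p`
  rw [sum_mem_eq_sum_ind_mul, sum_glue, sum_pd1]
  simp only [cellOf_glue, ind_inter_eq_mul, (ind_free_literal_vals ℓ hℓ hX₃ _).1, (ind_free_literal_vals ℓ hℓ hX₃ _).2.1,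
    (ind_free_literal_vals ℓ hℓ hX₃ _).2.2]
  have hz : ∀ z : Pd (k + 1), (nuCount (X₂ ∪ Y₂) z : ℤ) = nuCount X₂ z + nuCount Y₂ z - nuCount (X₂ ∩ Y₂) z :=
    fun z => nuCount_union_eq X₂ Y₂ z
  simp only [hz, ind_union_eq]
  rw [sum_glue (n := k) (k := 1), sum_glue (n := k) (k := 1), sum_glue (n := k) (k := 1)]
  simp only [sum_pd1, ind_glue_of_free hX₂, ind_glue_of_cell hY₂, nuCount_glue_of_free hX₂, nuCount_glue_of_cell hY₂,
    nuCount_glue_of_inter hX₂ hY₂, i0, i1, i2, n0, n1, n2]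
  rw [← Finset.sum_add_distrib, ← Finset.sum_add_distrib]
  refine Finset.sum_congr rfl fun t _ => ?_
  -- right side at fixed `t`: `M(t)·(2^k − ν_{↑b}(t))`
  have hr : ∀ (M : ℤ), (∑ t' : Pd k, (if TotDist t t' = true then (1:ℤ) else 0) * (M * ind Ob t * (1 - ind Ob t')))
      = M * ind Ob t * (2 ^ k - (nuCount Ob t : ℤ)) := by
    intro M
    rw [nuCount_eq_sum_ind, ← sum_ite_totDist_eq_two_pow t, mul_sub, Finset.mul_sum, Finset.mul_sum, ← Finset.sum_sub_distrib]
    refine Finset.sum_congr rfl fun t' _ => ?_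
    rw [totDist_symm t' t]
    ring
  have e := hr (-(ind A (glue (fun _ => 0) (glue t (fun _ => 0))) * ind A' (glue (fun _ => 0) (glue t (fun _ => 0))))
      - ind A (glue (fun _ => 0) (glue t (fun _ => 1))) * ind A' (glue (fun _ => 0) (glue t (fun _ => 1)))
      + 2 * (ind A (glue (fun _ => 0) (glue t (fun _ => 2))) * ind A' (glue (fun _ => 0) (glue t (fun _ => 2))))
      - ind A (glue (fun _ => 1) (glue t (fun _ => 0))) * ind A' (glue (fun _ => 1) (glue t (fun _ => 0)))
      - ind A (glue (fun _ => 1) (glue t (fun _ => 1))) * ind A' (glue (fun _ => 1) (glue t (fun _ => 1)))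
      + 2 * (ind A (glue (fun _ => 1) (glue t (fun _ => 2))) * ind A' (glue (fun _ => 1) (glue t (fun _ => 2)))))
  rw [pow_succ]
  rw [show (∑ t' : Pd k, (if TotDist t t' = true then (1:ℤ) else 0) *
          (
          -(ind A (glue (fun _ => 0) (glue t (fun _ => 0))) * ind A' (glue (fun _ => 0) (glue t (fun _ => 0))) * ind Ob t)
          - ind A (glue (fun _ => 0) (glue t (fun _ => 1))) * ind A' (glue (fun _ => 0) (glue t (fun _ => 1))) * ind Ob t
          + 2 * ind A (glue (fun _ => 0) (glue t (fun _ => 2))) * ind A' (glue (fun _ => 0) (glue t (fun _ => 2))) * ind Ob t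
          - ind A (glue (fun _ => 1) (glue t (fun _ => 0))) * ind A' (glue (fun _ => 1) (glue t (fun _ => 0))) * ind Ob t
          - ind A (glue (fun _ => 1) (glue t (fun _ => 1))) * ind A' (glue (fun _ => 1) (glue t (fun _ => 1))) * ind Ob t
          + 2 * ind A (glue (fun _ => 1) (glue t (fun _ => 2))) * ind A' (glue (fun _ => 1) (glue t (fun _ => 2))) * ind Ob t
          + ind A (glue (fun _ => 0) (glue t (fun _ => 0))) * ind A' (glue (fun _ => 0) (glue t (fun _ => 0))) * ind Ob t * ind Ob t'
          + ind A (glue (fun _ => 0) (glue t (fun _ => 1))) * ind A' (glue (fun _ => 0) (glue t (fun _ => 1))) * ind Ob t * ind Ob t'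
          - 2 * ind A (glue (fun _ => 0) (glue t (fun _ => 2))) * ind A' (glue (fun _ => 0) (glue t (fun _ => 2))) * ind Ob t * ind Ob t'
          + ind A (glue (fun _ => 1) (glue t (fun _ => 0))) * ind A' (glue (fun _ => 1) (glue t (fun _ => 0))) * ind Ob t * ind Ob t'
          + ind A (glue (fun _ => 1) (glue t (fun _ => 1))) * ind A' (glue (fun _ => 1) (glue t (fun _ => 1))) * ind Ob t * ind Ob t'
          - 2 * ind A (glue (fun _ => 1) (glue t (fun _ => 2))) * ind A' (glue (fun _ => 1) (glue t (fun _ => 2))) * ind Ob t * ind Ob t'))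
      = ∑ t' : Pd k, (if TotDist t t' = true then (1:ℤ) else 0) *
          ((-(ind A (glue (fun _ => 0) (glue t (fun _ => 0))) * ind A' (glue (fun _ => 0) (glue t (fun _ => 0))))
      - ind A (glue (fun _ => 0) (glue t (fun _ => 1))) * ind A' (glue (fun _ => 0) (glue t (fun _ => 1)))
      + 2 * (ind A (glue (fun _ => 0) (glue t (fun _ => 2))) * ind A' (glue (fun _ => 0) (glue t (fun _ => 2))))
      - ind A (glue (fun _ => 1) (glue t (fun _ => 0))) * ind A' (glue (fun _ => 1) (glue t (fun _ => 0)))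
      - ind A (glue (fun _ => 1) (glue t (fun _ => 1))) * ind A' (glue (fun _ => 1) (glue t (fun _ => 1)))
      + 2 * (ind A (glue (fun _ => 1) (glue t (fun _ => 2))) * ind A' (glue (fun _ => 1) (glue t (fun _ => 2)))))
          * ind Ob t * (1 - ind Ob t')) from Finset.sum_congr rfl fun t' _ => by ring, e]
  ring

/-! ### The nonnegative families in T-form -/

/-- **Coefficientwise Harris on `[3]^{k+1}` in T-form**: for up-sets `P, Q ⊆ [3]^{k+1}`,
`0 ≤ Σ_{t,t'}[t δ̸ t']·Σ_{(p,p')} P(t,p)(Q(t,p) − Q(t',p'))`. [this work] -/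
theorem harris_tform_nonneg (P Q : Finset (Pd (k + 1))) (hP : IsUpperSet (P : Set (Pd (k + 1)))) (hQ : IsUpperSet (Q : Set (Pd (k + 1)))) :
    0 ≤ ∑ t : Pd k, ∑ t' : Pd k, (if TotDist t t' = true then (1:ℤ) else 0) *
          (ind P (glue t (fun _ => 0)) * (ind Q (glue t (fun _ => 0)) - ind Q (glue t' (fun _ => 1)))
            + ind P (glue t (fun _ => 0)) * (ind Q (glue t (fun _ => 0)) - ind Q (glue t' (fun _ => 2)))
            + ind P (glue t (fun _ => 1)) * (ind Q (glue t (fun _ => 1)) - ind Q (glue t' (fun _ => 0)))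
            + ind P (glue t (fun _ => 1)) * (ind Q (glue t (fun _ => 1)) - ind Q (glue t' (fun _ => 2)))
            + ind P (glue t (fun _ => 2)) * (ind Q (glue t (fun _ => 2)) - ind Q (glue t' (fun _ => 0)))
            + ind P (glue t (fun _ => 2)) * (ind Q (glue t (fun _ => 2)) - ind Q (glue t' (fun _ => 1)))) := by
  have h := pairKernel_harris_nonneg P Q hP hQ
  have h2 := pairSum_cell_pd1_explicit (fun z z' => ind P z * (ind Q z - ind Q z'))
  rw [h2] at h
  exact h

/-- **Fibre Kleitman on `[3]^{k+1}` in T-form**: for up-sets `P, Q` and any `V`,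
`0 ≤ Σ_{t,t'}[t δ̸ t']·Σ_{(p,p',p'')} V(t,p)P(t',p')(Q(t',p') − Q(t'',p''))`. [this work] -/
theorem kleitman_tform_nonneg (V P Q : Finset (Pd (k + 1))) (hP : IsUpperSet (P : Set (Pd (k + 1)))) (hQ : IsUpperSet (Q : Set (Pd (k + 1)))) :
    0 ≤ ∑ t : Pd k, ∑ t' : Pd k, (if TotDist t t' = true then (1:ℤ) else 0) *
          (ind V (glue t (fun _ => 0)) * ind P (glue t' (fun _ => 1)) * (ind Q (glue t' (fun _ => 1)) - ind Q (glue (thirdPt t t') (fun _ => 2)))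
            + ind V (glue t (fun _ => 0)) * ind P (glue t' (fun _ => 2)) * (ind Q (glue t' (fun _ => 2)) - ind Q (glue (thirdPt t t') (fun _ => 1)))
            + ind V (glue t (fun _ => 1)) * ind P (glue t' (fun _ => 0)) * (ind Q (glue t' (fun _ => 0)) - ind Q (glue (thirdPt t t') (fun _ => 2)))
            + ind V (glue t (fun _ => 1)) * ind P (glue t' (fun _ => 2)) * (ind Q (glue t' (fun _ => 2)) - ind Q (glue (thirdPt t t') (fun _ => 0)))
            + ind V (glue t (fun _ => 2)) * ind P (glue t' (fun _ => 0)) * (ind Q (glue t' (fun _ => 0)) - ind Q (glue (thirdPt t t') (fun _ => 1)))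
            + ind V (glue t (fun _ => 2)) * ind P (glue t' (fun _ => 1)) * (ind Q (glue t' (fun _ => 1)) - ind Q (glue (thirdPt t t') (fun _ => 0)))) := by
  have h := pairKernel_kleitman_nonneg V P Q hP hQ
  have h2 := pairSum_cell_pd1_explicit (fun z z' => ind V z * ind P z' * (ind Q z' - ind Q (thirdPt z z')))
  rw [h2] at h
  obtain ⟨-, -, -, -, -, -, -, -, -, t01, t02, t10, t12, t20, t21⟩ := pd1_facts
  simp only [thirdPt_glue, t01, t02, t10, t12, t20, t21] at h
  exact h

/-- **The level-2 two-orthant slack in T-form** (`…TwoOrthant`, `…TwoOrthantTop`; the ORTHANT pays): for `b ∈ {1,2}^k` (`k ≥ 1`) and up-sets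
`P, Q ⊆ [3]^{k+1}`, `0 ≤ sStarD (X₂∪Y₂) P Q − Φ₂(P∩Q) = Σ_{t,t'}[t δ̸ t']·K_F(P,Q)(t,t',t'')` with the explicit kernel below
(the two-block kernel `κ_L` of `sStarD_union_sub_pairCertSlack_eq_pairSum`, literal axis explicit). [this work] -/
theorem twoOrthantCell_tform_nonneg (b : Pd k) (hb : (∃ i, b i = 2) ∨ (∀ i, b i = 1)) (hk : 0 < k) (ℓ : Pd 1) (hℓ : ℓ 0 = 2)
    {X₂ Y₂ : Finset (Pd (k + 1))}
    (hX₂ : ∀ t p, glue t p ∈ X₂ ↔ t ∈ (univ.filter fun x : Pd k => ∀ j, b j ≤ x j))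
    (hY₂ : ∀ t p, glue t p ∈ Y₂ ↔ p ∈ (univ.filter fun y : Pd 1 => ∀ j, ℓ j ≤ y j))
    (P Q : Finset (Pd (k + 1))) (hP : IsUpperSet (P : Set (Pd (k + 1)))) (hQ : IsUpperSet (Q : Set (Pd (k + 1)))) :
    0 ≤ ∑ t : Pd k, ∑ t' : Pd k, (if TotDist t t' = true then (1:ℤ) else 0) *
          (ind P (glue t (fun _ => 0)) * ind Q (glue t (fun _ => 0)) + ind P (glue t (fun _ => 0)) * ind Q (glue t' (fun _ => 1))
          - ind P (glue t (fun _ => 0)) * ind Q (glue t' (fun _ => 2)) + ind P (glue t (fun _ => 1)) * ind Q (glue t (fun _ => 1))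
          + ind P (glue t (fun _ => 1)) * ind Q (glue t' (fun _ => 0)) - ind P (glue t (fun _ => 1)) * ind Q (glue t' (fun _ => 2))
          + 2 * ind P (glue t (fun _ => 2)) * ind Q (glue t (fun _ => 2)) - ind P (glue t' (fun _ => 0)) * ind Q (glue t' (fun _ => 0))
          - ind P (glue t' (fun _ => 1)) * ind Q (glue t' (fun _ => 1)) - ind P (glue t' (fun _ => 2)) * ind Q (glue t (fun _ => 0))
          - ind P (glue t' (fun _ => 2)) * ind Q (glue t (fun _ => 1))
          + ind P (glue t (fun _ => 0)) * ind Q (glue t (fun _ => 0)) * ind (univ.filter fun x : Pd k => ∀ j, b j ≤ x j) t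
          + ind P (glue t (fun _ => 0)) * ind Q (glue t (fun _ => 0)) * ind (univ.filter fun x : Pd k => ∀ j, b j ≤ x j) t'
          - ind P (glue t (fun _ => 0)) * ind Q (glue t' (fun _ => 1)) * ind (univ.filter fun x : Pd k => ∀ j, b j ≤ x j) t'
          + ind P (glue t (fun _ => 0)) * ind Q (glue t' (fun _ => 2)) * ind (univ.filter fun x : Pd k => ∀ j, b j ≤ x j) (thirdPt t t')
          + ind P (glue t (fun _ => 1)) * ind Q (glue t (fun _ => 1)) * ind (univ.filter fun x : Pd k => ∀ j, b j ≤ x j) t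
          + ind P (glue t (fun _ => 1)) * ind Q (glue t (fun _ => 1)) * ind (univ.filter fun x : Pd k => ∀ j, b j ≤ x j) t'
          - ind P (glue t (fun _ => 1)) * ind Q (glue t' (fun _ => 0)) * ind (univ.filter fun x : Pd k => ∀ j, b j ≤ x j) t'
          + ind P (glue t (fun _ => 1)) * ind Q (glue t' (fun _ => 2)) * ind (univ.filter fun x : Pd k => ∀ j, b j ≤ x j) (thirdPt t t')
          + 2 * ind P (glue t (fun _ => 2)) * ind Q (glue t (fun _ => 2)) * ind (univ.filter fun x : Pd k => ∀ j, b j ≤ x j) t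
          + 2 * ind P (glue t (fun _ => 2)) * ind Q (glue t (fun _ => 2)) * ind (univ.filter fun x : Pd k => ∀ j, b j ≤ x j) t'
          - ind P (glue t (fun _ => 2)) * ind Q (glue t' (fun _ => 0)) * ind (univ.filter fun x : Pd k => ∀ j, b j ≤ x j) t'
          + ind P (glue t (fun _ => 2)) * ind Q (glue t' (fun _ => 0)) * ind (univ.filter fun x : Pd k => ∀ j, b j ≤ x j) (thirdPt t t')
          - ind P (glue t (fun _ => 2)) * ind Q (glue t' (fun _ => 1)) * ind (univ.filter fun x : Pd k => ∀ j, b j ≤ x j) t'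
          + ind P (glue t (fun _ => 2)) * ind Q (glue t' (fun _ => 1)) * ind (univ.filter fun x : Pd k => ∀ j, b j ≤ x j) (thirdPt t t')
          - ind P (glue t' (fun _ => 0)) * ind Q (glue t (fun _ => 1)) * ind (univ.filter fun x : Pd k => ∀ j, b j ≤ x j) t'
          - ind P (glue t' (fun _ => 0)) * ind Q (glue t (fun _ => 2)) * ind (univ.filter fun x : Pd k => ∀ j, b j ≤ x j) t'
          - ind P (glue t' (fun _ => 0)) * ind Q (glue t' (fun _ => 0)) * ind (univ.filter fun x : Pd k => ∀ j, b j ≤ x j) t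
          - ind P (glue t' (fun _ => 1)) * ind Q (glue t (fun _ => 0)) * ind (univ.filter fun x : Pd k => ∀ j, b j ≤ x j) t'
          - ind P (glue t' (fun _ => 1)) * ind Q (glue t (fun _ => 2)) * ind (univ.filter fun x : Pd k => ∀ j, b j ≤ x j) t'
          - ind P (glue t' (fun _ => 1)) * ind Q (glue t' (fun _ => 1)) * ind (univ.filter fun x : Pd k => ∀ j, b j ≤ x j) t
          - 2 * ind P (glue t' (fun _ => 2)) * ind Q (glue t' (fun _ => 2)) * ind (univ.filter fun x : Pd k => ∀ j, b j ≤ x j) t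
          + ind P (glue t (fun _ => 0)) * ind Q (glue t (fun _ => 0)) * ind (univ.filter fun x : Pd k => ∀ j, b j ≤ x j) t * ind (univ.filter fun x : Pd k => ∀ j, b j ≤ x j) t'
          + ind P (glue t (fun _ => 1)) * ind Q (glue t (fun _ => 1)) * ind (univ.filter fun x : Pd k => ∀ j, b j ≤ x j) t * ind (univ.filter fun x : Pd k => ∀ j, b j ≤ x j) t'
          - 2 * ind P (glue t (fun _ => 2)) * ind Q (glue t (fun _ => 2)) * ind (univ.filter fun x : Pd k => ∀ j, b j ≤ x j) t * ind (univ.filter fun x : Pd k => ∀ j, b j ≤ x j) t') := by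
  have hS := (show _ from
    match hb with
    | Or.inl hb2 => twoOrthant_hS_of_two b hb2 ℓ hX₂ hY₂ P Q hP hQ
    | Or.inr hb1 => twoOrthant_hS_of_ones b hb1 hk ℓ hX₂ hY₂ P Q hP hQ)
  have h := sub_nonneg.2 hS
  have e := sStarD_union_sub_pairCertSlack_eq_pairSum hX₂ hY₂ P Q
  rw [e] at h
  set Ob : Finset (Pd k) := univ.filter fun x : Pd k => ∀ j, b j ≤ x j with hOb
  set L : Finset (Pd 1) := univ.filter fun y : Pd 1 => ∀ j, ℓ j ≤ y j with hL
  have e2 := pairSum2_pd1_explicit (fun (ξ η : Pd k) (q r : Pd 1) =>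
      ( 2 * (ind Ob ξ + ind L q - ind Ob ξ * ind L q) * ind P (glue ξ q) * ind Q (glue ξ q)
        - (ind Ob ξ + ind L q - ind Ob ξ * ind L q) * ind P (glue η r) * ind Q (glue η r)
        - ind P (glue ξ q) * (ind Ob η + ind L r - ind Ob η * ind L r) * ind Q (glue η r)
        - ind Q (glue ξ q) * (ind Ob η + ind L r - ind Ob η * ind L r) * ind P (glue η r)
        + ind P (glue ξ q) * ind Q (glue η r)
            * (ind Ob (thirdPt ξ η) + ind L (thirdPt q r) - ind Ob (thirdPt ξ η) * ind L (thirdPt q r))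
        - ind P (glue ξ q) * ind Q (glue ξ q)
            * ((1 - ind L q) * (ind Ob ξ - ind Ob η) + (1 - ind Ob ξ) * (1 - ind Ob η) * (ind L q - ind L r)) ))
  rw [e2] at h
  obtain ⟨i0, i1, i2⟩ := ind_literalTwo_vals ℓ hℓ
  rw [← hL] at i0 i1 i2
  obtain ⟨-, -, -, -, -, -, -, -, -, t01, t02, t10, t12, t20, t21⟩ := pd1_facts
  simp only [t01, t02, t10, t12, t20, t21, i0, i1, i2] at h
  refine le_of_le_of_eq h ?_
  refine Finset.sum_congr rfl fun t _ => Finset.sum_congr rfl fun t' _ => ?_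
  ring

/-- **The trivial family in T-form is nonnegative**: the kernel `K_R(t,t',t'')` of the three-block certificate's remainder — products of
differences of `1_A, 1_{A'}` along comparable points with nonnegative orthant weights `1_{↑b}(t)(1+1_{↑b}(t'))`, `2+2·1_{↑b}(t)(1−1_{↑b}(t'))`,
`2·1_{↑b}(t)`, `2`, `1−1_{↑b}(t'')` — is pointwise nonnegative for up-sets `A, A'`. [this work] -/
theorem threeStar_R_tform_nonneg (b : Pd k) {A A' : Finset (Pd (1 + (k + 1)))}
    (hA : IsUpperSet (A : Set (Pd (1 + (k + 1))))) (hA' : IsUpperSet (A' : Set (Pd (1 + (k + 1))))) :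
    0 ≤ ∑ t : Pd k, ∑ t' : Pd k, (if TotDist t t' = true then (1:ℤ) else 0) *
          (ind (univ.filter fun x : Pd k => ∀ j, b j ≤ x j) t * (1 + ind (univ.filter fun x : Pd k => ∀ j, b j ≤ x j) t')
            * ((ind A (glue (fun _ => 1) (glue t (fun _ => 0))) - ind A (glue (fun _ => 0) (glue t (fun _ => 0))))
              * (ind A' (glue (fun _ => 1) (glue t (fun _ => 0))) - ind A' (glue (fun _ => 0) (glue t (fun _ => 0))))
            + (ind A (glue (fun _ => 1) (glue t (fun _ => 1))) - ind A (glue (fun _ => 0) (glue t (fun _ => 1))))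
              * (ind A' (glue (fun _ => 1) (glue t (fun _ => 1))) - ind A' (glue (fun _ => 0) (glue t (fun _ => 1)))))
          + (2 + 2 * ind (univ.filter fun x : Pd k => ∀ j, b j ≤ x j) t * (1 - ind (univ.filter fun x : Pd k => ∀ j, b j ≤ x j) t'))
            * ((ind A (glue (fun _ => 1) (glue t (fun _ => 2))) - ind A (glue (fun _ => 0) (glue t (fun _ => 2))))
              * (ind A' (glue (fun _ => 1) (glue t (fun _ => 2))) - ind A' (glue (fun _ => 0) (glue t (fun _ => 2)))))
          + 2 * ind (univ.filter fun x : Pd k => ∀ j, b j ≤ x j) t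
            * ((ind A (glue (fun _ => 2) (glue t (fun _ => 0))) - ind A (glue (fun _ => 0) (glue t (fun _ => 0))))
              * (ind A' (glue (fun _ => 2) (glue t (fun _ => 0))) - ind A' (glue (fun _ => 0) (glue t (fun _ => 0))))
            + (ind A (glue (fun _ => 2) (glue t (fun _ => 0))) - ind A (glue (fun _ => 1) (glue t (fun _ => 0))))
              * (ind A' (glue (fun _ => 2) (glue t (fun _ => 0))) - ind A' (glue (fun _ => 1) (glue t (fun _ => 0))))
            + (ind A (glue (fun _ => 2) (glue t (fun _ => 1))) - ind A (glue (fun _ => 0) (glue t (fun _ => 1))))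
              * (ind A' (glue (fun _ => 2) (glue t (fun _ => 1))) - ind A' (glue (fun _ => 0) (glue t (fun _ => 1))))
            + (ind A (glue (fun _ => 2) (glue t (fun _ => 1))) - ind A (glue (fun _ => 1) (glue t (fun _ => 1))))
              * (ind A' (glue (fun _ => 2) (glue t (fun _ => 1))) - ind A' (glue (fun _ => 1) (glue t (fun _ => 1)))))
          + 2 * ((ind A (glue (fun _ => 2) (glue t (fun _ => 2))) - ind A (glue (fun _ => 0) (glue t (fun _ => 2))))
              * (ind A' (glue (fun _ => 2) (glue t (fun _ => 2))) - ind A' (glue (fun _ => 0) (glue t (fun _ => 2))))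
            + (ind A (glue (fun _ => 2) (glue t (fun _ => 2))) - ind A (glue (fun _ => 1) (glue t (fun _ => 2))))
              * (ind A' (glue (fun _ => 2) (glue t (fun _ => 2))) - ind A' (glue (fun _ => 1) (glue t (fun _ => 2)))))
          + (1 - ind (univ.filter fun x : Pd k => ∀ j, b j ≤ x j) (thirdPt t t'))
            * ((ind A (glue (fun _ => 2) (glue t (fun _ => 0))) - ind A (glue (fun _ => 0) (glue t (fun _ => 0))))
              * (ind A' (glue (fun _ => 2) (glue t' (fun _ => 2))) - ind A' (glue (fun _ => 1) (glue t' (fun _ => 2))))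
            + (ind A (glue (fun _ => 2) (glue t (fun _ => 0))) - ind A (glue (fun _ => 1) (glue t (fun _ => 0))))
              * (ind A' (glue (fun _ => 2) (glue t' (fun _ => 2))) - ind A' (glue (fun _ => 0) (glue t' (fun _ => 2))))
            + (ind A (glue (fun _ => 2) (glue t (fun _ => 1))) - ind A (glue (fun _ => 0) (glue t (fun _ => 1))))
              * (ind A' (glue (fun _ => 2) (glue t' (fun _ => 2))) - ind A' (glue (fun _ => 1) (glue t' (fun _ => 2))))
            + (ind A (glue (fun _ => 2) (glue t (fun _ => 1))) - ind A (glue (fun _ => 1) (glue t (fun _ => 1))))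
              * (ind A' (glue (fun _ => 2) (glue t' (fun _ => 2))) - ind A' (glue (fun _ => 0) (glue t' (fun _ => 2))))
            + (ind A (glue (fun _ => 2) (glue t (fun _ => 2))) - ind A (glue (fun _ => 0) (glue t (fun _ => 2))))
              * (ind A' (glue (fun _ => 2) (glue t' (fun _ => 0))) - ind A' (glue (fun _ => 1) (glue t' (fun _ => 0))))
            + (ind A (glue (fun _ => 2) (glue t (fun _ => 2))) - ind A (glue (fun _ => 0) (glue t (fun _ => 2))))
              * (ind A' (glue (fun _ => 2) (glue t' (fun _ => 1))) - ind A' (glue (fun _ => 1) (glue t' (fun _ => 1))))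
            + (ind A (glue (fun _ => 2) (glue t (fun _ => 2))) - ind A (glue (fun _ => 1) (glue t (fun _ => 2))))
              * (ind A' (glue (fun _ => 2) (glue t' (fun _ => 0))) - ind A' (glue (fun _ => 0) (glue t' (fun _ => 0))))
            + (ind A (glue (fun _ => 2) (glue t (fun _ => 2))) - ind A (glue (fun _ => 1) (glue t (fun _ => 2))))
              * (ind A' (glue (fun _ => 2) (glue t' (fun _ => 1))) - ind A' (glue (fun _ => 0) (glue t' (fun _ => 1)))))) := by
  set Ob : Finset (Pd k) := univ.filter fun x : Pd k => ∀ j, b j ≤ x j with hOb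
  have dA : ∀ (s : Pd k) (a1 a0 c1 c0 : Fin 3), c1 ≤ a1 → c0 ≤ a0 →
      0 ≤ ind A (glue (fun _ => a1) (glue s (fun _ => a0))) - ind A (glue (fun _ => c1) (glue s (fun _ => c0))) := by
    intro s a1 a0 c1 c0 h1 h0
    have hle : glue (fun _ => c1 : Pd 1) (glue s (fun _ => c0 : Pd 1)) ≤ glue (fun _ => a1) (glue s (fun _ => a0)) :=
      glue_le_glue_iff.2 ⟨fun _ => h1, glue_le_glue_iff.2 ⟨le_rfl, fun _ => h0⟩⟩
    linarith [ind_le_ind_of_imp (S := A) (T := A) (fun h => hA hle h)]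
  have dA' : ∀ (s : Pd k) (a1 a0 c1 c0 : Fin 3), c1 ≤ a1 → c0 ≤ a0 →
      0 ≤ ind A' (glue (fun _ => a1) (glue s (fun _ => a0))) - ind A' (glue (fun _ => c1) (glue s (fun _ => c0))) := by
    intro s a1 a0 c1 c0 h1 h0
    have hle : glue (fun _ => c1 : Pd 1) (glue s (fun _ => c0 : Pd 1)) ≤ glue (fun _ => a1) (glue s (fun _ => a0)) :=
      glue_le_glue_iff.2 ⟨fun _ => h1, glue_le_glue_iff.2 ⟨le_rfl, fun _ => h0⟩⟩
    linarith [ind_le_ind_of_imp (S := A') (T := A') (fun h => hA' hle h)]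
  refine Finset.sum_nonneg fun t _ => Finset.sum_nonneg fun t' _ => mul_nonneg (by split_ifs <;> norm_num) ?_
  have y0 := ind_nonneg' Ob t
  have y1' := ind_le_one' Ob t'
  have y1 := ind_nonneg' Ob t'
  have y2' := ind_le_one' Ob (thirdPt t t')
  exact add_nonneg (add_nonneg (add_nonneg (add_nonneg
    (mul_nonneg (mul_nonneg y0 (by linarith)) (add_nonneg (mul_nonneg (dA t 1 0 0 0 (by decide) (by decide)) (dA' t 1 0 0 0 (by decide) (by decide))) (mul_nonneg (dA t 1 1 0 1 (by decide) (by decide)) (dA' t 1 1 0 1 (by decide) (by decide)))))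
    (mul_nonneg (by nlinarith [mul_nonneg y0 (sub_nonneg.2 y1')]) (mul_nonneg (dA t 1 2 0 2 (by decide) (by decide)) (dA' t 1 2 0 2 (by decide) (by decide)))))
    (mul_nonneg (by linarith) (add_nonneg (add_nonneg (add_nonneg (mul_nonneg (dA t 2 0 0 0 (by decide) (by decide)) (dA' t 2 0 0 0 (by decide) (by decide))) (mul_nonneg (dA t 2 0 1 0 (by decide) (by decide)) (dA' t 2 0 1 0 (by decide) (by decide)))) (mul_nonneg (dA t 2 1 0 1 (by decide) (by decide)) (dA' t 2 1 0 1 (by decide) (by decide)))) (mul_nonneg (dA t 2 1 1 1 (by decide) (by decide)) (dA' t 2 1 1 1 (by decide) (by decide))))))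
    (mul_nonneg (by norm_num) (add_nonneg (mul_nonneg (dA t 2 2 0 2 (by decide) (by decide)) (dA' t 2 2 0 2 (by decide) (by decide))) (mul_nonneg (dA t 2 2 1 2 (by decide) (by decide)) (dA' t 2 2 1 2 (by decide) (by decide))))))
    (mul_nonneg (sub_nonneg.2 y2') (add_nonneg (add_nonneg (add_nonneg (add_nonneg (add_nonneg (add_nonneg (add_nonneg (mul_nonneg (dA t 2 0 0 0 (by decide) (by decide)) (dA' t' 2 2 1 2 (by decide) (by decide))) (mul_nonneg (dA t 2 0 1 0 (by decide) (by decide)) (dA' t' 2 2 0 2 (by decide) (by decide)))) (mul_nonneg (dA t 2 1 0 1 (by decide) (by decide)) (dA' t' 2 2 1 2 (by decide) (by decide)))) (mul_nonneg (dA t 2 1 1 1 (by decide) (by decide)) (dA' t' 2 2 0 2 (by decide) (by decide)))) (mul_nonneg (dA t 2 2 0 2 (by decide) (by decide)) (dA' t' 2 0 1 0 (by decide) (by decide)))) (mul_nonneg (dA t 2 2 0 2 (by decide) (by decide)) (dA' t' 2 1 1 1 (by decide) (by decide)))) (mul_nonneg (dA t 2 2 1 2 (by decide) (by decide)) (dA'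 t' 2 0 0 0 (by decide) (by decide)))) (mul_nonneg (dA t 2 2 1 2 (by decide) (by decide)) (dA' t' 2 1 0 1 (by decide) (by decide)))))

end Summit.CriticalPhenomena.PercolationContinuityZ3.Theorems.SahiGridPattern
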